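import Summits.BirchSwinnertonDyer.BirchSwinnertonDyer.Theorems.CycTangentCMCycTangentBoundSplitPrimeSaturation
import Summits.BirchSwinnertonDyer.BirchSwinnertonDyer.Theorems.PrintCf2SplitBadTwoGeneratorPairSupply
import Literature.NumberTheory.EllipticCurves.ZpExtensionSplitLineProofs
import HarnessLib

/-!
# The split-prime line through a generator pair is SATURATED at EVERY prime `p` (including `p = 2`):
# input of brick B18 (two-variable Katz–de Shalit frame uniqueness at `p = 2`)

Width brick **B18** (planner `bsd-print-cf2-plan` g18, `bricks/B18_KatzFrameUniquenessAtTwo.lean`; vet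
`bsd-vet-cf2-C` g0 finding F2) for crux `stmt-BirchSwinnertonDyer-20368` `PrintCf2.SplitBadTwoRankOneOfFacts`
(road α v10.3; route-C items 23721 `RubinValueFormulaAtTwo` / 23722 `RestrictedMainConjWithValueAtTwo` read the
measure `G₂` under a `∀ G₂, IsKatzMeasure₂ … G₂ → …` frame at `p = 2`), cell `bsd-print-cf2`, seat
`bsd-line-cf2-p1-w5` g4.  Theses-free; `--supports` the crux.  FILE 1 of 2.

The tree's frame-uniqueness theorem `CycTangentCMKatzFrameUniqueness.isKatzMeasure₂_unique` carries
`hp2 : p ≠ 2`, and the hypothesis enters its proof at exactly ONE place: the split-prime line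
`CycTangentCMCycTangentBoundSplitPrimeSaturation.exists_splitPrimeLine_factorsThroughZp` ⟵
`exists_splitPrimeLine_saturated`, whose proof presents the line as `t'κ₁ − s'κ₂` and needs (a) Brink's
"the anticyclotomic tower is ramified above `p`" (odd `p` used only to make the layers unramified at the
infinite places) and (b) the RANK-ONE property of inertia in the `ℤ_p²`-tower via the cyclicity of
`(ℤ/p^m)ˣ` — false as stated for `p = 2`.  THIS FILE re-proves the same packaged statement for EVERY
prime `p` by a different route, from class field theory already PROVED in the tree:

* §1 `exists_inertia_not_le_kerSubgroup` — **no `ℤ_p`-extension of an imaginary quadratic field is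
  everywhere unramified** (any `p`): otherwise every layer `K_n/K` is abelian of degree `pⁿ`, unramified at
  the finite places (`isUnramifiedIn_layer_of_forall_inertia_le`) and at the infinite ones (`K` is totally
  complex), so `pⁿ ∣ h_K` for all `n` (`hilbertClassField.finrank_dvd_classNumber_of_abelian`) — the tree's
  proof of `inertia_not_le_kerSubgroup_of_isAnticyclotomic` with `IsUnramifiedAtInfinitePlaces_of_odd_finrank`
  replaced by total complexity.
* §2 `inertia_le_kerSubgroup_of_isUnramifiedOutside` — Agboola's `κ.IsUnramifiedOutside v` (stated with the
  tree's CHOSEN inertia group `GreenbergSelmer.inertia w`) controls EVERY inertia group `I_𝔓`, `𝔓 ∣ w ≠ v`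
  (conjugate primes, `κ` a class function); `exists_mem_inertia_toAdd_ne_zero_of_split` — at a split
  `p = v v̄` SOME inertia element `τ₀` above `v̄` moves the `ℤ_p²`-tower: apply §1 to THE `ℤ_p`-extension
  unramified outside `v̄` (`ZpExtension.exists_isUnramifiedOutside_of_split`, -w6 g3, any `p`), which is
  through the pair (`GeneratorPairSupply.pairKer_le_kerSubgroup`, -w4 g7, any `p`).
* §3 **`exists_splitPrimeLine_saturated_of_split`** — the conclusion of the tree's
  `exists_splitPrimeLine_saturated` WITHOUT `hp2`: the line is `κ :=` THE `ℤ_p`-extension unramified outside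
  `v`; it is through the pair; saturation: `κ = aκ₁ + bκ₂` with `(a, b) ≠ 0` kills `τ₀` (unramified at `v̄`)
  and `σ`, so the coordinates of `σ` are `λ·(s', t')` where `(κ₁τ₀, κ₂τ₀) = pᵉ(s', t')` is primitive
  (`2 × 2` linear algebra over the domain `ℤ_p`), whence `r(σ)^{pᵉ} = r(σ^{pᵉ}) = 1` by the tree's
  `avatarValueAt_eq_one_of_pairMap_eq_mul` and `r(τ₀) = 1`.
* §4 **`exists_splitPrimeLine_factorsThroughZp_of_split`** — the consumer's packaging (§3 + the tree's
  `isUnramifiedAt_avatar_of_hasInfinityType_zero` + `avatarValueAt_torsionFree_of_norm_sub_one_lt`), i.e.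
  `exists_splitPrimeLine_factorsThroughZp` with `hp2` deleted.

File 2 (`…KatzFrameUniquenessAtTwo`) runs the odd-`p` uniqueness proof on §4.  THEOREMS ONLY (no `def`, no
fact, no `sorry`); nothing is closed; beyond-print theorem: no (de Shalit II.4.17 / Greenberg 1978 §4 state
the split-prime line for all `p`).  BSD is not proved by any of this.

References: [deShalit1987] II.4.17 (p. 77), III.1.8; [Greenberg1978] §4 p. 94; [Brink2007] Cor. 1;
[Washington1997] §13.1, Prop. 13.2, Thm. 13.4; [Cox2013] §5.C Cor. 5.24.
-/

set_option linter.dupNamespace false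
set_option autoImplicit false

noncomputable section

open scoped NumberField
open NumberField IsDedekindDomain Field
open Literature Literature.NumberTheory.GaloisRepresentations Literature.NumberTheory.EllipticCurves
open Literature.NumberTheory.NumberFields
open Summit.BirchSwinnertonDyer.BirchSwinnertonDyer.Theorems.PrintCf2

namespace Summit.BirchSwinnertonDyer.BirchSwinnertonDyer.Theorems.PrintCf2.SplitPrimeLine

variable {p : ℕ} [Fact p.Prime] {K : Type} [Field K] [NumberField K]

/-! ### §1. No `ℤ_p`-extension of an imaginary quadratic field is everywhere unramified -/

/-- **No `ℤ_p`-extension of an imaginary quadratic field is unramified at every finite place** (any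
prime `p`): some inertia group `I_𝔓 ≤ Γ_K` is not contained in `ker κ = Gal(K̄/K_∞)`.  Otherwise every layer
`K_n/K` (abelian of degree `pⁿ`) is unramified at all finite places and — `K` being totally complex — at the
infinite ones, so `pⁿ ∣ h_K` for every `n` (Hilbert class field), absurd.
[cite: Washington1997, §13.1 Prop. 13.2 and the remark following Thm. 13.4] [cite: Cox2013, §5.C Cor. 5.24]
[cite: Brink2007, Cor. 1 (p. 2136), proof] -/
theorem exists_inertia_not_le_kerSubgroup (hK : IsImaginaryQuadratic K) (κ : ZpExtension K p) :
    ∃ (w : HeightOneSpectrum (𝓞 K)) (𝔓 : Ideal (absIntegers (𝓞 K) K)), 𝔓 ∈ w.primesAbove ∧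
      ¬ 𝔓.inertia (absoluteGaloisGroup K) ≤ κ.kerSubgroup := by
  by_contra hall
  push Not at hall
  have hp : p.Prime := Fact.out
  have himag : ∀ w : InfinitePlace K, w.IsComplex := fun w ↦ hK.2.isComplex w
  -- every layer has degree `pⁿ` dividing the class number
  have hdvd : ∀ n : ℕ, p ^ n ∣ Fintype.card (ClassGroup (𝓞 K)) := by
    intro n
    haveI : FiniteDimensional K (κ.layer n) := κ.finiteDimensional_layer_holds n
    haveI : IsGalois K (κ.layer n) := κ.isGalois_layer_holds n
    haveI : IsAbelianGalois K (κ.layer n) := κ.isAbelianGalois_layer n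
    haveI : NumberField (κ.layer n) := NumberField.of_module_finite K (κ.layer n)
    haveI : IsUnramifiedAtInfinitePlaces K (κ.layer n) :=
      ⟨fun w ↦ (InfinitePlace.isUnramified_iff).mpr (Or.inr (himag _))⟩
    have h := hilbertClassField.finrank_dvd_classNumber_of_abelian K (κ.layer n)
      (fun w ↦ ZpExtension.isUnramifiedIn_layer_of_forall_inertia_le κ
        (fun w 𝔓 h𝔓 ↦ hall w 𝔓 h𝔓) n w)
    rwa [κ.finrank_layer_holds n] at h
  -- but `p ^ h_K > h_K`
  have hpos : 0 < Fintype.card (ClassGroup (𝓞 K)) := Fintype.card_pos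
  exact absurd (Nat.le_of_dvd hpos (hdvd _)) (not_le.mpr (Nat.lt_pow_self hp.one_lt))

/-! ### §2. Unramified outside `v`: all inertia groups at `w ≠ v`; an inertia element above `v̄` moving the tower -/

/-- **`κ.IsUnramifiedOutside v` controls every inertia group above every `w ≠ v`**: the predicate is
stated with the chosen inertia group `GreenbergSelmer.inertia w = I_{𝔓₀(w)}`; any other prime `𝔓 ∣ w` of
`\bar ℤ_K` is `Γ_K`-conjugate to `𝔓₀(w)` and `κ` is constant on conjugacy classes.
[cite: Agboola2007, §1 p. 1] [cite: NeukirchANT1999, Ch. I §9 Prop. (9.1)] -/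
theorem inertia_le_kerSubgroup_of_isUnramifiedOutside {κ : ZpExtension K p} {v : HeightOneSpectrum (𝓞 K)}
    (hκ : κ.IsUnramifiedOutside v) {w : HeightOneSpectrum (𝓞 K)} (hw : w ≠ v)
    {𝔓 : Ideal (absIntegers (𝓞 K) K)} (h𝔓 : 𝔓 ∈ w.primesAbove) :
    𝔓.inertia (absoluteGaloisGroup K) ≤ κ.kerSubgroup := by
  intro τ hτ
  have e : GreenbergSelmer.inertia w = (adicCompletionPrime K w).inertia (absoluteGaloisGroup K) :=
    (inertia_adicCompletionPrime_eq_map_absInertia K w).symm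
  obtain ⟨τ₀, hτ₀, h1, -⟩ :=
    ZpExtension.exists_mem_inertia_apply_eq κ κ (adicCompletionPrime_mem_primesAbove K w) h𝔓 hτ
  have hτ₀' : τ₀ ∈ GreenbergSelmer.inertia w := by rw [e]; exact hτ₀
  rw [ZpExtension.mem_kerSubgroup, ← h1]
  exact hκ.apply_eq_one hw hτ₀'

/-- **At a split prime `p = v v̄` of an imaginary quadratic field some inertia element above `v̄` acts
non-trivially on the `ℤ_p²`-tower** (any `p`): THE `ℤ_p`-extension `κ'` unramified outside `v̄` (class
field theory, `ZpExtension.exists_isUnramifiedOutside_of_split`) is ramified somewhere (§1), hence above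
`v̄` (§2); an inertia element `τ₀` with `κ' τ₀ ≠ 1` has a non-zero coordinate in any generator pair since
`κ'` is through the pair (`GeneratorPairSupply.pairKer_le_kerSubgroup`).
[cite: deShalit1987, II.4.17 (p. 77)] [cite: Greenberg1978, §4 p. 94] [cite: Washington1997, Thm. 13.4] -/
theorem exists_mem_inertia_toAdd_ne_zero_of_split (hK : IsImaginaryQuadratic K)
    {v vbar : HeightOneSpectrum (𝓞 K)} (hpv : ((p : ℕ) : 𝓞 K) ∈ v.asIdeal)
    (hpvbar : ((p : ℕ) : 𝓞 K) ∈ vbar.asIdeal) (hne : vbar ≠ v)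
    {κ₁ κ₂ : ZpExtension K p} {γ₁ γ₂ : absoluteGaloisGroup K}
    (hpair : ZpExtension.IsTopGeneratorPair κ₁ κ₂ γ₁ γ₂) :
    ∃ 𝔓₀ ∈ vbar.primesAbove, ∃ τ₀ ∈ 𝔓₀.inertia (absoluteGaloisGroup K),
      ¬ (Multiplicative.toAdd (κ₁ τ₀) = 0 ∧ Multiplicative.toAdd (κ₂ τ₀) = 0) := by
  obtain ⟨κ', hκ'⟩ := ZpExtension.exists_isUnramifiedOutside_of_split (p := p) hK hpvbar hpv hne.symm
  obtain ⟨w, 𝔓, h𝔓, hnot⟩ := exists_inertia_not_le_kerSubgroup hK κ'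
  have hw : w = vbar := by
    by_contra hw
    exact hnot (inertia_le_kerSubgroup_of_isUnramifiedOutside hκ' hw h𝔓)
  subst hw
  obtain ⟨τ₀, hτ₀, hτ₀ne⟩ : ∃ τ₀ ∈ 𝔓.inertia (absoluteGaloisGroup K), κ' τ₀ ≠ 1 := by
    by_contra h
    push Not at h
    exact hnot fun τ hτ ↦ ZpExtension.mem_kerSubgroup.mpr (h τ hτ)
  refine ⟨𝔓, h𝔓, τ₀, hτ₀, ?_⟩
  rintro ⟨h1, h2⟩
  have hk₁ : κ₁ τ₀ = 1 := by rw [← ofAdd_toAdd (κ₁ τ₀), h1, ofAdd_zero]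
  have hk₂ : κ₂ τ₀ = 1 := by rw [← ofAdd_toAdd (κ₂ τ₀), h2, ofAdd_zero]
  have hmem : τ₀ ∈ ZpExtension.pairKer κ₁ κ₂ := ZpExtension.mem_pairKer_iff.mpr ⟨hk₁, hk₂⟩
  exact hτ₀ne (ZpExtension.mem_kerSubgroup.mp
    (GeneratorPairSupply.pairKer_le_kerSubgroup hK.unitsRank_eq_zero hK.nrComplexPlaces_eq_one hpair κ'
      hmem))

/-! ### §3. Saturation of the split-prime line, every `p` -/

/-- **THE SPLIT-PRIME LINE THROUGH A GENERATOR PAIR IS SATURATED FOR CHARACTERS UNRAMIFIED AT `v̄`, at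
EVERY prime `p`.**  For `K` imaginary quadratic, `p = v v̄` split (`v ≠ v̄`) and a generator pair
`(κ₁, κ₂; γ₁, γ₂)` there is a `ℤ_p`-quotient `κ` with (i) `ker κ₁ ∩ ker κ₂ ≤ ker κ`, (ii) `I_𝔓 ≤ ker κ` for
every prime `𝔓` of `\bar ℤ_K` above `v̄`, and (iii) every rank-one `r` THROUGH THE PAIR, UNRAMIFIED AT `v̄`,
whose values have NO `p`-POWER TORSION, FACTORS THROUGH `κ`.  (`κ` = THE `ℤ_p`-extension unramified outside
`v`; (iii): `κ = aκ₁ + bκ₂`, `(a, b) ≠ 0`, kills `σ ∈ ker κ` and an inertia element `τ₀` above `v̄` with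
primitive direction `(s', t')`, `(κ₁τ₀, κ₂τ₀) = pᵉ(s', t') ≠ 0` (§2); so `σ` has coordinates `λ(s', t')` and
`r(σ)^{pᵉ} = r(σ^{pᵉ}) = 1`.)  Same conclusion as the tree's `exists_splitPrimeLine_saturated`, `hp2` deleted.
[cite: deShalit1987, II.4.17 (p. 77), III.1.8 (p. 94)] [cite: Greenberg1978, §4 p. 94]
[cite: Washington1997, §13.1, Thm. 13.4] -/
theorem exists_splitPrimeLine_saturated_of_split (hK : IsImaginaryQuadratic K)
    {v vbar : HeightOneSpectrum (𝓞 K)} (hpv : ((p : ℕ) : 𝓞 K) ∈ v.asIdeal)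
    (hpvbar : ((p : ℕ) : 𝓞 K) ∈ vbar.asIdeal) (hne : vbar ≠ v)
    {κ₁ κ₂ : ZpExtension K p} {γ₁ γ₂ : absoluteGaloisGroup K}
    (hpair : ZpExtension.IsTopGeneratorPair κ₁ κ₂ γ₁ γ₂) :
    ∃ κ : ZpExtension K p, ZpExtension.pairKer κ₁ κ₂ ≤ κ.kerSubgroup ∧
      (∀ 𝔓 ∈ vbar.primesAbove, 𝔓.inertia (absoluteGaloisGroup K) ≤ κ.kerSubgroup) ∧
      ∀ r : FramedGaloisRep K (PadicAlgCl p) 1, FactorsThroughPair κ₁ κ₂ r → r.IsUnramifiedAt vbar →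
        (∀ (σ : absoluteGaloisGroup K) (n : ℕ), avatarValueAt r σ ^ p ^ n = 1 → avatarValueAt r σ = 1) →
        FactorsThroughZp κ r := by
  have h0 : NumberField.Units.rank K = 0 := hK.unitsRank_eq_zero
  have h1 : NumberField.InfinitePlace.nrComplexPlaces K = 1 := hK.nrComplexPlaces_eq_one
  -- THE line unramified outside `v`
  obtain ⟨κ, hκ⟩ := ZpExtension.exists_isUnramifiedOutside_of_split (p := p) hK hpv hpvbar hne
  -- an inertia element above `v̄` moving the tower
  obtain ⟨𝔓₀, h𝔓₀, τ₀, hτ₀, hst⟩ := exists_mem_inertia_toAdd_ne_zero_of_split hK hpv hpvbar hne hpair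
  have hinert : ∀ 𝔓 ∈ vbar.primesAbove, 𝔓.inertia (absoluteGaloisGroup K) ≤ κ.kerSubgroup :=
    fun 𝔓 h𝔓 ↦ inertia_le_kerSubgroup_of_isUnramifiedOutside hκ hne h𝔓
  refine ⟨κ, GeneratorPairSupply.pairKer_le_kerSubgroup h0 h1 hpair κ, hinert,
    fun r hrpair hrunr htors σ hσ ↦ ?_⟩
  -- coordinates of `κ` in the pair
  obtain ⟨a, b, hab⟩ := GeneratorPairSupply.exists_coeff_of_isTopGeneratorPair h0 h1 hpair
    κ.toContinuousMonoidHom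
  simp only [ZpExtension.coe_toContinuousMonoidHom] at hab
  set s : ℤ_[p] := Multiplicative.toAdd (κ₁ τ₀) with hs_def
  set t : ℤ_[p] := Multiplicative.toAdd (κ₂ τ₀) with ht_def
  set x : ℤ_[p] := Multiplicative.toAdd (κ₁ σ) with hx_def
  set y : ℤ_[p] := Multiplicative.toAdd (κ₂ σ) with hy_def
  obtain ⟨e, s', t', hs, ht, hunit⟩ := ZpExtension.exists_pow_mul_of_ne_zero s t hst
  -- `κ` kills `τ₀` (unramified at `v̄`) and `σ`
  have hκτ₀ : Multiplicative.toAdd (κ τ₀) = 0 := by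
    rw [ZpExtension.mem_kerSubgroup.mp (hinert 𝔓₀ h𝔓₀ hτ₀), toAdd_one]
  have hκσ : Multiplicative.toAdd (κ σ) = 0 := by
    rw [ZpExtension.mem_kerSubgroup.mp hσ, toAdd_one]
  have hst0 : a * s + b * t = 0 := by rw [← hab τ₀, hκτ₀]
  have hxy0 : a * x + b * y = 0 := by rw [← hab σ, hκσ]
  have hpe : ((p : ℤ_[p]) ^ e) ≠ 0 := pow_ne_zero _ (NeZero.ne _)
  have hst0' : a * s' + b * t' = 0 := by
    have : (p : ℤ_[p]) ^ e * (a * s' + b * t') = 0 := by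
      rw [hs, ht] at hst0
      linear_combination hst0
    exact (mul_eq_zero.mp this).resolve_left hpe
  -- `(a, b) ≠ 0` since `κ` is onto `ℤ_p`
  have hab0 : ¬ (a = 0 ∧ b = 0) := by
    rintro ⟨rfl, rfl⟩
    obtain ⟨g, hg⟩ := κ.surjective (Multiplicative.ofAdd 1)
    have h := hab g
    rw [ZpExtension.coe_toContinuousMonoidHom] at hg
    rw [hg, toAdd_ofAdd, zero_mul, zero_mul, add_zero] at h
    exact one_ne_zero h
  -- hence the coordinates of `σ` are proportional to `(s', t')`
  have hlin : t' * Multiplicative.toAdd (κ₁ σ) + (-s') * Multiplicative.toAdd (κ₂ σ) = 0 := by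
    rw [← hx_def, ← hy_def]
    rcases not_and_or.mp hab0 with ha | hb
    · have : a * (t' * x + (-s') * y) = 0 := by linear_combination t' * hxy0 - y * hst0'
      exact (mul_eq_zero.mp this).resolve_left ha
    · have : b * (t' * x + (-s') * y) = 0 := by linear_combination x * hst0' - s' * hxy0
      exact (mul_eq_zero.mp this).resolve_left hb
  obtain ⟨lam, hl1, hl2⟩ : ∃ lam : ℤ_[p], Multiplicative.toAdd (κ₁ σ) = lam * s' ∧
      Multiplicative.toAdd (κ₂ σ) = lam * t' := by
    rcases hunit with hs' | ht'
    · obtain ⟨u, hu⟩ := hs'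
      refine ⟨Multiplicative.toAdd (κ₁ σ) * ↑u⁻¹, by rw [mul_assoc, ← hu, Units.inv_mul, mul_one], ?_⟩
      have hts : s' * Multiplicative.toAdd (κ₂ σ) = t' * Multiplicative.toAdd (κ₁ σ) := by
        linear_combination -hlin
      calc Multiplicative.toAdd (κ₂ σ) = ↑u⁻¹ * (s' * Multiplicative.toAdd (κ₂ σ)) := by
            rw [← hu, ← mul_assoc, Units.inv_mul, one_mul]
        _ = Multiplicative.toAdd (κ₁ σ) * ↑u⁻¹ * t' := by rw [hts]; ring
    · obtain ⟨u, hu⟩ := ht'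
      refine ⟨Multiplicative.toAdd (κ₂ σ) * ↑u⁻¹, ?_, by rw [mul_assoc, ← hu, Units.inv_mul, mul_one]⟩
      have hts : t' * Multiplicative.toAdd (κ₁ σ) = s' * Multiplicative.toAdd (κ₂ σ) := by
        linear_combination hlin
      calc Multiplicative.toAdd (κ₁ σ) = ↑u⁻¹ * (t' * Multiplicative.toAdd (κ₁ σ)) := by
            rw [← hu, ← mul_assoc, Units.inv_mul, one_mul]
        _ = Multiplicative.toAdd (κ₂ σ) * ↑u⁻¹ * s' := by rw [hts]; ring
  -- `r(τ₀) = 1` since `r` is unramified at `v̄`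
  have hr0 : avatarValueAt r τ₀ = 1 := by
    rw [avatarValueAt, hrunr 𝔓₀ h𝔓₀ τ₀ hτ₀]; simp
  -- `σ^{pᵉ}` has coordinates `λ (s, t)`
  have hpow1 : Multiplicative.toAdd (κ₁ (σ ^ p ^ e)) = lam * Multiplicative.toAdd (κ₁ τ₀) := by
    rw [map_pow, toAdd_pow, nsmul_eq_mul, hl1, ← hs_def, hs]; push_cast; ring
  have hpow2 : Multiplicative.toAdd (κ₂ (σ ^ p ^ e)) = lam * Multiplicative.toAdd (κ₂ τ₀) := by
    rw [map_pow, toAdd_pow, nsmul_eq_mul, hl2, ← ht_def, ht]; push_cast; ring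
  have hval := avatarValueAt_eq_one_of_pairMap_eq_mul hpair hrpair hr0 lam (σ ^ p ^ e) hpow1 hpow2
  rw [RamifiedSevenEllipticUnits.LemmaXi.avatarValueAt_pow] at hval
  exact eq_one_of_avatarValueAt_eq_one (htors σ e hval)

/-! ### §4. Packaged for the consumer: type-`(k, 0)` characters through the pair factor through the line -/

/-- **The split-prime line carries every type-`(k, 0)` interpolation character through the pair, at EVERY
prime `p`**: for `K` imaginary quadratic, `p = v v̄` split, `ι` normalised by the frames' clause `hι` and a
generator pair, ONE `ℤ_p`-quotient `κ` THROUGH THE PAIR and UNRAMIFIED AT `v̄` carries every `p`-adic avatar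
`r`, through the pair and with `‖r(σ) − 1‖ < ‖p‖`, of every Hecke character of type `(k, 0)` unramified at
`v̄`: `FactorsThroughZp κ r` (§3 + the tree's `isUnramifiedAt_avatar_of_hasInfinityType_zero` and
`avatarValueAt_torsionFree_of_norm_sub_one_lt`).  Same statement as the tree's
`exists_splitPrimeLine_factorsThroughZp`, `hp2` deleted.
[cite: deShalit1987, II.4.17 (p. 77)] [cite: SerreAbelianLadic1968, Ch. III §2.3] -/
theorem exists_splitPrimeLine_factorsThroughZp_of_split (hK : IsImaginaryQuadratic K)
    (ι : PadicAlgCl p ≃+* ℂ) {v vbar : HeightOneSpectrum (𝓞 K)} (hpv : ((p : ℕ) : 𝓞 K) ∈ v.asIdeal)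
    (hpvbar : ((p : ℕ) : 𝓞 K) ∈ vbar.asIdeal) (hne : vbar ≠ v)
    (hι : ∀ (w : InfinitePlace K) (d : 𝓞 K), d ∈ v.asIdeal ↔ ‖ι.symm (w.embedding (d : K))‖ < 1)
    {κ₁ κ₂ : ZpExtension K p} {γ₁ γ₂ : absoluteGaloisGroup K}
    (hpair : ZpExtension.IsTopGeneratorPair κ₁ κ₂ γ₁ γ₂) :
    ∃ κ : ZpExtension K p, ZpExtension.pairKer κ₁ κ₂ ≤ κ.kerSubgroup ∧
      (∀ 𝔓 ∈ vbar.primesAbove, 𝔓.inertia (absoluteGaloisGroup K) ≤ κ.kerSubgroup) ∧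
      ∀ (φ : HeckeCharacter K) (k : ℤ) (T : Finset (HeightOneSpectrum (𝓞 K)))
        (r : FramedGaloisRep K (PadicAlgCl p) 1),
        φ.HasInfinityType (fun _ ↦ k) (fun _ ↦ 0) → (∀ w, w ∉ T → φ.IsUnramifiedAt w) →
        φ.IsUnramifiedAt vbar → IsPAdicAvatarOf ι φ r → FactorsThroughPair κ₁ κ₂ r →
        (∀ σ : absoluteGaloisGroup K, ‖avatarValueAt r σ - 1‖ < ‖(p : ℂ_[p])‖) →
        FactorsThroughZp κ r := by
  have himag : ∀ w : InfinitePlace K, w.IsComplex := fun w ↦ hK.2.isComplex w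
  obtain ⟨κ, hκpair, hκinert, hsat⟩ := exists_splitPrimeLine_saturated_of_split hK hpv hpvbar hne hpair
  refine ⟨κ, hκpair, hκinert, fun φ k T r hinf hT hunr hav hrpair hsmall ↦ ?_⟩
  exact hsat r hrpair (isUnramifiedAt_avatar_of_hasInfinityType_zero ι himag hpvbar hne hι hinf hT hunr hav)
    (avatarValueAt_torsionFree_of_norm_sub_one_lt hsmall)

end Summit.BirchSwinnertonDyer.BirchSwinnertonDyer.Theorems.PrintCf2.SplitPrimeLine

end
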